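import Summits.Ventures.PercRepro.GenQBalance

/-!
# PercRepro — C-025 at `(q + 2, q)`: the dichotomy at every `q` and every type, and the residue (night-4, gen 0;
part B of two, part A = `GenQBalance.lean`)

With the general balance `Jq M G q t` of `GenQBalance.lean` (`= J M G t` at `q = 4`), this file proves what is
STRUCTURAL in the `(6, 4)` residue of record — valid for every `q` and every type `t ≤ q` by the same counting, with
no table:

* **`Jq_nonneg_of_not_twoHyp`** — THE DICHOTOMY AT EVERY `q` AND EVERY `t ≤ q`: if `G` is not covered by two sets
  of rank `≤ q − 1` and two points (`¬ TwoHyp M G q`, mine-2's `G ∉ 𝔉`), then `0 ≤ Jq M G q t`.  At `(6, 4)` this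
  is Lemma 21.4 for `t = 3, 4`; the proof is the complementation pairing of §21.4 in injection form: a thin
  demanding set has a non-thin demanding complement (`sdiff_mem_of_thin`), so `#U₁ ≤ #U₀`, and
  `#U₀·(q + 2 − t) + #U₁·(q + 2 − t)/(q + 1) ≥ Φ·(#U₀ + #U₁)` reduces to `(q + 2)(q − t) ≥ 0`;
* `Jq_top_nonneg_of_hyp_add_one`: «hyperplane + one point» is demand-free at the top type `t = q`;
* `PerFlatResidue q` / `PerFlatAll q` and **`perFlatAll_of_residue`**: the whole per-flat balance at `(q + 2, q)`
  on simple matroids reduces to the family `𝔉` — the exact general analogue of the `(6, 4)` residue of record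
  (at `q = 4`, `TwentyOnePrime ∧ PlaneAddTwoFour ∧ PlaneLineFourBig` and the `g ≤ 9` clauses all live inside `𝔉`).

What is NOT here (the genuinely size-dependent part): the balance on `𝔉` itself, closed at `q = 4` by the
per-profile tables and tails of p1 / p2 / p5, and the general `(q + 2, q)` frame (the `|E|`-induction of
`SixFourFrame` with the parallel step at `(q + 1, q − 1)`).
-/

namespace PercRepro.GenQ

open Finset ThmH SixFour

variable {α : Type*} [DecidableEq α] {M : Matroid α} [M.Finite]

/-! ## The dichotomy at every `q` and every type `t ≤ q` -/

omit [M.Finite] in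
/-- The rank of a subset of `G` is at most `ρ(G)`. -/
theorem eRk_sdiff_le {G B : Finset α} : M.eRk ((G \ B : Finset α) : Set α) ≤ M.eRk (G : Set α) :=
  M.eRk_mono (by rw [Finset.coe_sdiff]; exact Set.sdiff_subset)

/-- In `𝔉`'s complement, a thin demanding set has a non-thin demanding complement of rank `q`. -/
theorem sdiff_mem_of_thin {G B : Finset α} {q t : ℕ} (hG : G ⊆ gr M) (hrG : M.eRk (G : Set α) = (q : ℕ∞))
    (hF : ¬ TwoHyp M G q) (ht : t ≤ q) (hB : B ∈ Rq M G q)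
    (_hd : ¬ (M.eRk ((G \ B : Finset α) : Set α) + 1 ≤ (t : ℕ∞))) (hm : mTr M B ≠ 0) :
    G \ B ∈ (((Rq M G q).filter
      (fun B : Finset α => ¬ (M.eRk ((G \ B : Finset α) : Set α) + 1 ≤ (t : ℕ∞)))).filter
        (fun B : Finset α => mTr M B = 0)) := by
  have hB' := mem_Rq.1 hB
  -- the complement has rank exactly `q`
  have hle : M.eRk ((G \ B : Finset α) : Set α) ≤ (q : ℕ∞) := by
    rw [← hrG]; exact eRk_sdiff_le
  have hrc : M.eRk ((G \ B : Finset α) : Set α) = (q : ℕ∞) := by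
    by_contra hne
    have hlt : M.eRk ((G \ B : Finset α) : Set α) < (q : ℕ∞) := lt_of_le_of_ne hle hne
    have hfin : M.eRk ((G \ B : Finset α) : Set α) ≠ ⊤ := by
      exact ne_top_of_lt hlt
    have hc : M.eRk ((G \ B : Finset α) : Set α) + 1 ≤ (q : ℕ∞) := by
      exact Order.add_one_le_of_lt hlt
    exact hF (twoHyp_of_thin_of_sdiff_lt hG hB'.1 hB'.2 hm hc)
  -- the complement is not thin
  have hm' : mTr M (G \ B) = 0 := by
    by_contra hm'
    exact hF (twoHyp_of_thin_of_thin hG hB'.1 hB'.2 hm hrc hm')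
  rw [Finset.mem_filter, Finset.mem_filter, mem_Rq]
  refine ⟨⟨⟨Finset.sdiff_subset, hrc⟩, ?_⟩, hm'⟩
  rw [Finset.sdiff_sdiff_eq_self hB'.1, hB'.2]
  intro hq
  have hq' : (q + 1 : ℕ) ≤ t := by exact_mod_cast hq
  omega

/-- **The dichotomy at every `q` and every type `t ≤ q`** (mine-2's Lemma 21.4 in general): if `G` is not
covered by two sets of rank `≤ q − 1` and two points, the balance `0 ≤ Jq M G q t` holds. -/
theorem Jq_nonneg_of_not_twoHyp {G : Finset α} {q t : ℕ} (hG : G ⊆ gr M)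
    (hrG : M.eRk (G : Set α) = (q : ℕ∞)) (hF : ¬ TwoHyp M G q) (ht : t ≤ q) : 0 ≤ Jq M G q t := by
  classical
  -- the demanding sets, split into non-thin (`U₀`) and thin (`U₁`)
  set U := (Rq M G q).filter
    (fun B : Finset α => ¬ (M.eRk ((G \ B : Finset α) : Set α) + 1 ≤ (t : ℕ∞))) with hU
  set U₀ := U.filter (fun B : Finset α => mTr M B = 0) with hU₀
  set U₁ := U.filter (fun B : Finset α => ¬ mTr M B = 0) with hU₁
  have hsplit : (U₀.card : ℚ) + (U₁.card : ℚ) = (U.card : ℚ) := by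
    rw [hU₀, hU₁]
    exact_mod_cast Finset.card_filter_add_card_filter_not _
  -- complementation injects `U₁` into `U₀`
  have hinj : U₁.card ≤ U₀.card := by
    apply Finset.card_le_card_of_injOn (fun B : Finset α => G \ B)
    · intro B hB
      rw [hU₁, Finset.mem_coe, Finset.mem_filter, hU, Finset.mem_filter] at hB
      exact sdiff_mem_of_thin hG hrG hF ht hB.1.1 hB.1.2 hB.2
    · intro B hB B' hB' hBB'
      rw [hU₁, Finset.mem_coe, Finset.mem_filter, hU, Finset.mem_filter, mem_Rq] at hB hB'
      simp only at hBB'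
      rw [← Finset.sdiff_sdiff_eq_self hB.1.1.1, ← Finset.sdiff_sdiff_eq_self hB'.1.1.1, hBB']
  -- the supply of the demanding sets
  have hs : (0 : ℚ) ≤ (q : ℚ) + 2 - t := by
    have : (t : ℚ) ≤ q := by exact_mod_cast ht
    linarith
  have hq1 : (0 : ℚ) < (q : ℚ) + 1 := by positivity
  have hsub : ∑ B ∈ U, ((q : ℚ) + 2 - t) * wInf M B ≤ ∑ B ∈ Rq M G q, ((q : ℚ) + 2 - t) * wInf M B := by
    apply Finset.sum_le_sum_of_subset_of_nonneg (Finset.filter_subset _ _)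
    intro B _ _
    exact mul_nonneg hs (wInf_pos B).le
  have hsplitsum : ∑ B ∈ U, ((q : ℚ) + 2 - t) * wInf M B =
      ∑ B ∈ U₀, ((q : ℚ) + 2 - t) * wInf M B + ∑ B ∈ U₁, ((q : ℚ) + 2 - t) * wInf M B := by
    rw [hU₀, hU₁]
    exact (Finset.sum_filter_add_sum_filter_not _ _ _).symm
  have h0 : (U₀.card : ℚ) * ((q : ℚ) + 2 - t) ≤ ∑ B ∈ U₀, ((q : ℚ) + 2 - t) * wInf M B := by
    rw [← nsmul_eq_mul]
    apply Finset.card_nsmul_le_sum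
    intro B hB
    rw [hU₀, Finset.mem_filter] at hB
    have hw : wInf M B = 1 := by
      unfold wInf
      rw [hB.2]
      norm_num
    rw [hw, mul_one]
  have h1 : (U₁.card : ℚ) * (((q : ℚ) + 2 - t) * (1 / ((q : ℚ) + 1))) ≤
      ∑ B ∈ U₁, ((q : ℚ) + 2 - t) * wInf M B := by
    rw [← nsmul_eq_mul]
    apply Finset.card_nsmul_le_sum
    intro B hB
    rw [hU₁, Finset.mem_filter, hU, Finset.mem_filter, mem_Rq] at hB
    have hw := wInf_ge_of_eRk_eq (hB.1.1.1.trans hG) hB.1.1.2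
    exact mul_le_mul_of_nonneg_left hw hs
  -- assemble
  unfold Jq
  rw [Nq_sub_DFq, ← hU, ← hsplit]
  have hX0 : (0 : ℚ) ≤ U₀.card := by positivity
  have hX1 : (0 : ℚ) ≤ U₁.card := by positivity
  have hX : (U₁.card : ℚ) ≤ U₀.card := by exact_mod_cast hinj
  have htq : (t : ℚ) ≤ q := by exact_mod_cast ht
  have hq0 : (0 : ℚ) ≤ q := by positivity
  -- the supply bound
  have hsupply : (U₀.card : ℚ) * ((q : ℚ) + 2 - t) + (U₁.card : ℚ) * (((q : ℚ) + 2 - t) * (1 / ((q : ℚ) + 1))) ≤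
      ∑ B ∈ Rq M G q, ((q : ℚ) + 2 - t) * wInf M B := by
    linarith
  -- the arithmetic: multiply through by `q + 1`
  have key : (((q : ℚ) + 2) / ((q : ℚ) + 1)) * ((U₀.card : ℚ) + (U₁.card : ℚ)) ≤
      (U₀.card : ℚ) * ((q : ℚ) + 2 - t) + (U₁.card : ℚ) * (((q : ℚ) + 2 - t) * (1 / ((q : ℚ) + 1))) := by
    rw [div_mul_eq_mul_div, div_le_iff₀ hq1]
    have e1 : ((U₀.card : ℚ) * ((q : ℚ) + 2 - t) + (U₁.card : ℚ) * (((q : ℚ) + 2 - t) * (1 / ((q : ℚ) + 1)))) *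
        ((q : ℚ) + 1) = (U₀.card : ℚ) * ((q : ℚ) + 2 - t) * ((q : ℚ) + 1) + (U₁.card : ℚ) * ((q : ℚ) + 2 - t) := by
      field_simp
    rw [e1]
    nlinarith [mul_le_mul_of_nonneg_right hX (le_trans (by positivity : (0 : ℚ) ≤ t) le_rfl),
      mul_nonneg hX0 (mul_nonneg (by positivity : (0 : ℚ) ≤ (q : ℚ) + 2) (sub_nonneg.2 htq))]
  linarith

/-! ## «Hyperplane + one point» at the top type -/

/-- At the top type `t = q`, a set `G ⊆ Z ∪ {a}` with `ρ(Z) ≤ q − 1` has no demanding rank-`q` subset, so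
`0 ≤ Jq M G q q`. -/
theorem Jq_top_nonneg_of_hyp_add_one {G Z : Finset α} {a : α} {q : ℕ}
    (hrZ : M.eRk (Z : Set α) + 1 ≤ (q : ℕ∞)) (hcov : G ⊆ insert a Z) :
    0 ≤ Jq M G q q := by
  classical
  have hDF : DFq M G q q = Nq M G q := by
    unfold DFq Nq
    apply Finset.card_filter_eq_iff.2
    intro B hB
    have hB' := mem_Rq.1 hB
    have haB : a ∈ B := by
      by_contra haB
      -- then `B ⊆ Z` has rank `< q`
      have hBZ : B ⊆ Z := by
        intro x hx
        have := hcov (hB'.1 hx)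
        rw [Finset.mem_insert] at this
        rcases this with rfl | h
        · exact absurd hx haB
        · exact h
      have h1 : M.eRk (B : Set α) ≤ M.eRk (Z : Set α) := M.eRk_mono (Finset.coe_subset.2 hBZ)
      rw [hB'.2] at h1
      have h2' : (q : ℕ∞) + 1 ≤ M.eRk (Z : Set α) + 1 := by gcongr
      have h2 : (q : ℕ∞) + 1 ≤ (q : ℕ∞) := le_trans h2' hrZ
      have h3 : (q + 1 : ℕ) ≤ q := by exact_mod_cast h2
      omega
    have hsub : G \ B ⊆ Z := by
      intro x hx
      rw [Finset.mem_sdiff] at hx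
      have := hcov hx.1
      rw [Finset.mem_insert] at this
      rcases this with rfl | h
      · exact absurd haB hx.2
      · exact h
    calc M.eRk ((G \ B : Finset α) : Set α) + 1 ≤ M.eRk (Z : Set α) + 1 := by
          gcongr
          exact M.eRk_mono (Finset.coe_subset.2 hsub)
      _ ≤ (q : ℕ∞) := hrZ
  unfold Jq
  rw [hDF, sub_self, mul_zero, sub_zero]
  apply Finset.sum_nonneg
  intro B _
  have hs : (0 : ℚ) ≤ (q : ℚ) + 2 - q := by linarith
  exact mul_nonneg hs (wInf_pos B).le

/-! ## The residue at `(q + 2, q)` -/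

/-- **The per-flat residue at `(q + 2, q)`**: the balance at every type `t ≤ q` on the family `𝔉` of simple
matroids — the exact general analogue of the `(6, 4)` residue of record. -/
def PerFlatResidue (q : ℕ) : Prop :=
  ∀ {β : Type} [DecidableEq β] (M : Matroid β) [M.Finite] (G : Finset β), Simple M → G ⊆ gr M →
    M.eRk (G : Set β) = (q : ℕ∞) → TwoHyp M G q → ∀ t ≤ q, 0 ≤ Jq M G q t

/-- **The whole per-flat balance at `(q + 2, q)`** on simple matroids. -/
def PerFlatAll (q : ℕ) : Prop :=
  ∀ {β : Type} [DecidableEq β] (M : Matroid β) [M.Finite] (G : Finset β), Simple M → G ⊆ gr M →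
    M.eRk (G : Set β) = (q : ℕ∞) → ∀ t ≤ q, 0 ≤ Jq M G q t

/-- **The balance reduces to the family `𝔉`** at every `q`: `PerFlatResidue q → PerFlatAll q`. -/
theorem perFlatAll_of_residue {q : ℕ} (h : PerFlatResidue q) : PerFlatAll q := by
  intro β _ M _ G hs hG hr t ht
  by_cases hF : TwoHyp M G q
  · exact h M G hs hG hr hF t ht
  · exact Jq_nonneg_of_not_twoHyp hG hr hF ht

end PercRepro.GenQ
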